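import Mathlib
import Literature.Geometry.Lorentzian.ReggeWheelerTortoise
import Summits.FinalStateConjecture.FinalStateConjecture.Theorems.PhotonSphereChannelsRWPotential

/-!
# Route PhotonSphereChannels — far-field asymptotics of the Regge–Wheeler potential on the tortoise line

Item `FixedModeChannels` (stmt-FinalStateConjecture-10048), FAR half, and its uniform version K1R:
the comparison dynamics on the far cone `{x > xc + ρ + |t|}` is the exact inverse-square equation
`φ_tt − φ_xx + ℓ(ℓ+1)(x − xc)⁻²φ = 0`, and every perturbative step (Duhamel comparison, true
non-radiating kernel by Volterra iteration) is driven by the smallness of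
`V − ℓ(ℓ+1)(x − xc)⁻²` far out. This file quantifies it, uniformly over all tortoise radius
functions with the photon sphere at `xc` (the item's hypothesis block `r > 2M`, `r' = 1 − 2M/r`,
`r(xc) = 3M`):

* `tortoise_far_bounds_centered` — (companion of `Theorems.tortoise_far_bounds` of
  `PhotonSphereChannelsFarPotential.lean`, which is centred at `x₀ = xc − r*(3M)`; here the centre is
  the photon sphere `xc` itself) for `x ≥ xc`, with `d = x − xc`:
  `d + 3M − 2M log(1 + d/M) ≤ r(x) ≤ d + 3M` and `d/3 + 3M ≤ r(x)` (from the tortoise identity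
  `r − 3M + 2M log((r−2M)/M) = x − xc` of `ReggeWheelerTortoise.lean`);
* `rwPotential_far_asymptotics` — for `d ≥ 3M` and `s ≤ 2`:
  `|V_{s,ℓ}(x) − ℓ(ℓ+1)/d²| ≤ 200 M (ℓ(ℓ+1)+1) (1 + log(1 + d/M)) / d³`
  (the `M log d / d³` Coulomb-logarithm tail of the route thesis);
* `rwPotential_rescaled_close` — the RESCALED potential `V₁(y) = ρ² V(xc + ρy)` of the unit-cone
  reduction (`Literature.Analysis.PDE.farChannelInequality_of_unitScale`) satisfies, for every
  `ε > 0`, all `ρ ≥ ρ₀(M, ℓ, ε)` and all `y ≥ ½`:  `|V₁(y) − ℓ(ℓ+1)/y²| ≤ ε · y^{−5/2}`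
  (`ρ₀` independent of the tortoise function; `1 + log(1+ρ/M) = o(ρ)`).
Pure real analysis; no new definitions.
-/

noncomputable section

namespace Summit.FinalStateConjecture.FinalStateConjecture.Theorems

open Real Set Filter Literature.Geometry.Lorentzian.ReggeWheeler
open scoped _root_.Topology

variable {M : ℝ} {r : ℝ → ℝ} {xc : ℝ}

/-- **Two-sided far bounds for the tortoise radius.** For `x ≥ xc` and `d = x − xc`:
`d + 3M − 2M log(1 + d/M) ≤ r x ≤ d + 3M` and `d/3 + 3M ≤ r x`. -/
theorem tortoise_far_bounds_centered (hM : 0 < M) (hr : ∀ x, 2 * M < r x)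
    (hr' : ∀ x, HasDerivAt r (1 - 2 * M / r x) x) (hxc : r xc = 3 * M) {x : ℝ} (hx : xc ≤ x) :
    (x - xc) + 3 * M - 2 * M * Real.log (1 + (x - xc) / M) ≤ r x ∧ r x ≤ (x - xc) + 3 * M ∧
      (x - xc) / 3 + 3 * M ≤ r x := by
  have hT : IsTortoiseRadius M r xc := isTortoiseRadius_iff.2 ⟨hr, hr', hxc⟩
  have h3 : 3 * M ≤ r x := (three_mul_le_tortoise_iff hM hr hr' hxc x).2 hx
  have h2 : 0 < r x - 2 * M := by linarith [hr x]
  -- the tortoise identity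
  have hid : r x - 3 * M + 2 * M * Real.log ((r x - 2 * M) / M) = x - xc := by
    have e := hT.tortoiseCoord_eq x
    unfold tortoiseCoord at e
    rw [Real.log_div h2.ne' hM.ne']
    linarith
  set u : ℝ := (r x - 2 * M) / M with hu
  have hu1 : 1 ≤ u := by rw [hu, le_div_iff₀ hM]; linarith
  have hu0 : 0 < u := lt_of_lt_of_le one_pos hu1
  have hlog0 : 0 ≤ Real.log u := Real.log_nonneg hu1
  have hlog1 : Real.log u ≤ u - 1 := Real.log_le_sub_one_of_pos hu0
  have hum1 : u - 1 = (r x - 3 * M) / M := by rw [hu]; field_simp; ring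
  refine ⟨?_, ?_, ?_⟩
  · -- `u ≤ 1 + d/M`
    have hule : u ≤ 1 + (x - xc) / M := by
      have h1 : r x - 2 * M ≤ (x - xc) + M := by nlinarith [hid, hlog0]
      rw [hu, div_le_iff₀ hM]
      rw [add_mul, one_mul, div_mul_cancel₀ _ hM.ne']
      linarith
    have hlogle : Real.log u ≤ Real.log (1 + (x - xc) / M) := Real.log_le_log hu0 hule
    nlinarith [hid, hlogle, hM]
  · nlinarith [hid, hlog0]
  · have h1 : 2 * M * Real.log u ≤ 2 * (r x - 3 * M) := by
      have := mul_le_mul_of_nonneg_left hlog1 (by positivity : (0 : ℝ) ≤ 2 * M)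
      rw [hum1] at this
      have e : 2 * M * ((r x - 3 * M) / M) = 2 * (r x - 3 * M) := by field_simp
      linarith
    nlinarith [hid, h1]

/-- `log(1 + y) ≤ 2 √(1 + y)` (`y ≥ −1`), from `log x ≤ x^ε/ε`. -/
theorem log_one_add_le_two_sqrt {y : ℝ} (hy : 0 ≤ 1 + y) :
    Real.log (1 + y) ≤ 2 * Real.sqrt (1 + y) := by
  have h := Real.log_le_rpow_div hy (by norm_num : (0 : ℝ) < 1 / 2)
  rw [Real.sqrt_eq_rpow]
  linarith [h]

/-- **Far asymptotics of the Regge–Wheeler potential.** For `x − xc = d ≥ 3M` and `s ≤ 2`: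
`|V_{s,ℓ}(x) − ℓ(ℓ+1)/d²| ≤ 200 M (ℓ(ℓ+1)+1)(1 + log(1 + d/M))/d³`. -/
theorem rwPotential_far_asymptotics (hM : 0 < M) (hr : ∀ x, 2 * M < r x)
    (hr' : ∀ x, HasDerivAt r (1 - 2 * M / r x) x) (hxc : r xc = 3 * M) (s ℓ : ℕ) (hs : s ≤ 2)
    {x : ℝ} (hx : xc + 3 * M ≤ x) :
    |(1 - 2 * M / r x) * ((ℓ : ℝ) * ((ℓ : ℝ) + 1) / r x ^ 2 + (1 - (s : ℝ) ^ 2) * (2 * M) / r x ^ 3)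
        - (ℓ : ℝ) * ((ℓ : ℝ) + 1) / (x - xc) ^ 2|
      ≤ 200 * M * ((ℓ : ℝ) * ((ℓ : ℝ) + 1) + 1) * (1 + Real.log (1 + (x - xc) / M))
          / (x - xc) ^ 3 := by
  set d : ℝ := x - xc with hd
  set L : ℝ := (ℓ : ℝ) * ((ℓ : ℝ) + 1) with hL
  set lg : ℝ := Real.log (1 + d / M) with hlg
  have hd3 : 3 * M ≤ d := by rw [hd]; linarith
  have hd0 : 0 < d := by linarith
  have hL0 : 0 ≤ L := by rw [hL]; positivity
  have hlg0 : 0 ≤ lg := Real.log_nonneg (by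
    have : 0 ≤ d / M := div_nonneg hd0.le hM.le
    linarith)
  obtain ⟨hlow, hup, hthird⟩ := tortoise_far_bounds_centered hM hr hr' hxc (x := x) (by linarith)
  have hr0 : 0 < r x := lt_trans (by positivity) (hr x)
  have hrd : d / 3 ≤ r x := by linarith
  -- `|r − d| ≤ β := 3M + 2M lg`
  set β : ℝ := 3 * M + 2 * M * lg with hβ
  have hβ0 : 0 ≤ β := by positivity
  have habs : |r x - d| ≤ β := by
    rw [abs_le]; constructor <;> [skip; linarith]
    have : d + 3 * M - 2 * M * lg ≤ r x := hlow
    linarith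
  -- `1/r ≤ 3/d`
  have hinv : 1 / r x ≤ 3 / d := by
    rw [div_le_div_iff₀ hr0 hd0]; linarith
  have hinv2 : 1 / r x ^ 2 ≤ 9 / d ^ 2 := by
    have := mul_le_mul hinv hinv (by positivity) (by positivity)
    calc 1 / r x ^ 2 = (1 / r x) * (1 / r x) := by field_simp
      _ ≤ (3 / d) * (3 / d) := this
      _ = 9 / d ^ 2 := by field_simp; ring
  have hinv3 : 1 / r x ^ 3 ≤ 27 / d ^ 3 := by
    have := mul_le_mul hinv2 hinv (by positivity) (by positivity)
    calc 1 / r x ^ 3 = (1 / r x ^ 2) * (1 / r x) := by field_simp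
      _ ≤ (9 / d ^ 2) * (3 / d) := this
      _ = 27 / d ^ 3 := by field_simp; ring
  -- `|1/r² − 1/d²| ≤ 27 β / d³`
  have hdiff : |1 / r x ^ 2 - 1 / d ^ 2| ≤ 27 * β / d ^ 3 := by
    have e : 1 / r x ^ 2 - 1 / d ^ 2 = (d - r x) * ((d + r x) * (1 / r x ^ 2) * (1 / d ^ 2)) := by
      field_simp; ring
    rw [e, abs_mul]
    have h1 : |d - r x| ≤ β := by rw [abs_sub_comm]; exact habs
    have h2 : 0 ≤ (d + r x) * (1 / r x ^ 2) * (1 / d ^ 2) := by positivity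
    rw [abs_of_nonneg h2]
    have h3 : (d + r x) * (1 / r x ^ 2) * (1 / d ^ 2) ≤ (3 * d) * (9 / d ^ 2) * (1 / d ^ 2) := by
      have hsum : d + r x ≤ 3 * d := by linarith
      gcongr
    have h4 : (3 * d) * (9 / d ^ 2) * (1 / d ^ 2) = 27 / d ^ 3 := by field_simp; ring
    calc |d - r x| * ((d + r x) * (1 / r x ^ 2) * (1 / d ^ 2))
        ≤ β * ((3 * d) * (9 / d ^ 2) * (1 / d ^ 2)) := mul_le_mul h1 h3 h2 hβ0
      _ = 27 * β / d ^ 3 := by rw [h4]; ring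
  -- the three pieces
  have hfac1 : |1 - 2 * M / r x| ≤ 1 := by
    have h1 : 0 < 1 - 2 * M / r x := by
      rw [sub_pos, div_lt_one hr0]; exact hr x
    have h2 : 1 - 2 * M / r x ≤ 1 := by
      have : 0 ≤ 2 * M / r x := by positivity
      linarith
    rw [abs_of_pos h1]; exact h2
  have hs3 : |1 - (s : ℝ) ^ 2| ≤ 3 := by
    interval_cases s <;> norm_num
  have hsplit : (1 - 2 * M / r x) * (L / r x ^ 2 + (1 - (s : ℝ) ^ 2) * (2 * M) / r x ^ 3) - L / d ^ 2
      = L * (1 / r x ^ 2 - 1 / d ^ 2) - 2 * M * L * (1 / r x ^ 3)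
        + (1 - 2 * M / r x) * (1 - (s : ℝ) ^ 2) * (2 * M) * (1 / r x ^ 3) := by
    field_simp; ring
  rw [hsplit]
  have hA : |L * (1 / r x ^ 2 - 1 / d ^ 2)| ≤ L * (27 * β / d ^ 3) := by
    rw [abs_mul, abs_of_nonneg hL0]; exact mul_le_mul_of_nonneg_left hdiff hL0
  have hB : |2 * M * L * (1 / r x ^ 3)| ≤ 2 * M * L * (27 / d ^ 3) := by
    rw [abs_of_nonneg (by positivity)]
    exact mul_le_mul_of_nonneg_left hinv3 (by positivity)
  have hC : |(1 - 2 * M / r x) * (1 - (s : ℝ) ^ 2) * (2 * M) * (1 / r x ^ 3)|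
      ≤ 1 * 3 * (2 * M) * (27 / d ^ 3) := by
    rw [abs_mul, abs_mul, abs_mul, abs_of_nonneg (by positivity : (0 : ℝ) ≤ 2 * M),
      abs_of_nonneg (by positivity : (0 : ℝ) ≤ 1 / r x ^ 3)]
    gcongr
  have htri : |L * (1 / r x ^ 2 - 1 / d ^ 2) - 2 * M * L * (1 / r x ^ 3)
        + (1 - 2 * M / r x) * (1 - (s : ℝ) ^ 2) * (2 * M) * (1 / r x ^ 3)|
      ≤ |L * (1 / r x ^ 2 - 1 / d ^ 2)| + |2 * M * L * (1 / r x ^ 3)|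
        + |(1 - 2 * M / r x) * (1 - (s : ℝ) ^ 2) * (2 * M) * (1 / r x ^ 3)| := by
    refine (abs_add_le _ _).trans ?_
    gcongr
    exact abs_sub _ _
  refine htri.trans ?_
  have hsum : L * (27 * β / d ^ 3) + 2 * M * L * (27 / d ^ 3) + 1 * 3 * (2 * M) * (27 / d ^ 3)
      ≤ 200 * M * (L + 1) * (1 + lg) / d ^ 3 := by
    rw [hβ]
    have hd3pos : 0 < d ^ 3 := by positivity
    -- clear denominators
    have key : L * (27 * (3 * M + 2 * M * lg)) + 2 * M * L * 27 + 1 * 3 * (2 * M) * 27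
        ≤ 200 * M * (L + 1) * (1 + lg) := by
      nlinarith [hL0, hlg0, hM.le, mul_nonneg hL0 hlg0, mul_nonneg hM.le hlg0,
        mul_nonneg (mul_nonneg hM.le hL0) hlg0]
    have e1 : L * (27 * (3 * M + 2 * M * lg) / d ^ 3) + 2 * M * L * (27 / d ^ 3)
        + 1 * 3 * (2 * M) * (27 / d ^ 3)
        = (L * (27 * (3 * M + 2 * M * lg)) + 2 * M * L * 27 + 1 * 3 * (2 * M) * 27) / d ^ 3 := by
      field_simp
    rw [e1, div_le_div_iff_of_pos_right hd3pos]
    exact key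
  linarith [hA, hB, hC, hsum]

/-- `(1 + log(1 + ρ/M))/ρ → 0` as `ρ → ∞`. -/
theorem tendsto_log_ratio_div (hM : 0 < M) :
    Tendsto (fun ρ : ℝ => (1 + Real.log (1 + ρ / M)) / ρ) atTop (𝓝 0) := by
  -- compare with `(1 + log 2 − log M + log ρ)/ρ` for `ρ ≥ M`
  have h1 : Tendsto (fun ρ : ℝ => Real.log ρ / ρ) atTop (𝓝 0) :=
    Real.isLittleO_log_id_atTop.tendsto_div_nhds_zero
  have h2 : Tendsto (fun ρ : ℝ => (1 + Real.log 2 - Real.log M) / ρ) atTop (𝓝 0) :=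
    tendsto_const_nhds.div_atTop tendsto_id
  have hsum : Tendsto (fun ρ : ℝ => (1 + Real.log 2 - Real.log M) / ρ + Real.log ρ / ρ)
      atTop (𝓝 0) := by simpa using h2.add h1
  have hlow : Tendsto (fun _ : ℝ => (0 : ℝ)) atTop (𝓝 0) := tendsto_const_nhds
  refine tendsto_of_tendsto_of_tendsto_of_le_of_le' hlow hsum ?_ ?_
  · filter_upwards [eventually_ge_atTop M] with ρ hρ
    have hρ0 : 0 < ρ := lt_of_lt_of_le hM hρ
    have : 0 ≤ Real.log (1 + ρ / M) := Real.log_nonneg (by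
      have := div_nonneg hρ0.le hM.le; linarith)
    positivity
  · filter_upwards [eventually_ge_atTop M] with ρ hρ
    have hρ0 : 0 < ρ := lt_of_lt_of_le hM hρ
    have hle : Real.log (1 + ρ / M) ≤ Real.log 2 - Real.log M + Real.log ρ := by
      have e : 1 + ρ / M = (M + ρ) / M := by field_simp
      rw [e, Real.log_div (by positivity) hM.ne']
      have : Real.log (M + ρ) ≤ Real.log (2 * ρ) :=
        Real.log_le_log (by positivity) (by linarith)
      rw [Real.log_mul (by norm_num) hρ0.ne'] at this
      linarith
    rw [← add_div]
    exact div_le_div_of_nonneg_right (by linarith) hρ0.le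

/-- **The rescaled far potential is `ε y^{−5/2}`-close to `ℓ(ℓ+1)/y²` on `y ≥ ½`.** For every
`M > 0`, `s ≤ 2`, `ℓ` and `ε > 0` there is `ρ₀ = ρ₀(M, ℓ, ε) > 0` such that for EVERY tortoise
radius function with the photon sphere at `xc`, every `ρ ≥ ρ₀` and every `y ≥ ½`:
`|ρ² V_{s,ℓ}(xc + ρ y) − ℓ(ℓ+1)/y²| ≤ ε · y^{−5/2}`. -/
theorem rwPotential_rescaled_close (hM : 0 < M) (s ℓ : ℕ) (hs : s ≤ 2) {ε : ℝ} (hε : 0 < ε) :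
    ∃ ρ₀ : ℝ, 0 < ρ₀ ∧ ∀ (r : ℝ → ℝ) (xc : ℝ), (∀ x, 2 * M < r x) →
      (∀ x, HasDerivAt r (1 - 2 * M / r x) x) → r xc = 3 * M → ∀ ρ : ℝ, ρ₀ ≤ ρ →
      ∀ y : ℝ, 1 / 2 ≤ y →
        |ρ ^ 2 * ((1 - 2 * M / r (xc + ρ * y)) * ((ℓ : ℝ) * ((ℓ : ℝ) + 1) / r (xc + ρ * y) ^ 2
            + (1 - (s : ℝ) ^ 2) * (2 * M) / r (xc + ρ * y) ^ 3))
          - (ℓ : ℝ) * ((ℓ : ℝ) + 1) / y ^ 2|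
        ≤ ε * y ^ (-(5 : ℝ) / 2) := by
  set L : ℝ := (ℓ : ℝ) * ((ℓ : ℝ) + 1) with hL
  set K : ℝ := 1200 * M * (L + 1) with hK
  have hL0 : 0 ≤ L := by rw [hL]; positivity
  have hK0 : 0 < K := by rw [hK]; positivity
  -- choose `ρ₀ ≥ 6M` with `K (1 + log(1+ρ/M))/ρ ≤ ε` beyond it
  have hev : ∀ᶠ ρ : ℝ in atTop, K * ((1 + Real.log (1 + ρ / M)) / ρ) ≤ ε := by
    have ht := (tendsto_log_ratio_div hM).const_mul K
    rw [mul_zero] at ht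
    exact (ht.eventually (ge_mem_nhds (by simpa using hε))).mono fun ρ h => h
  obtain ⟨ρ₁, hρ₁⟩ := (hev.and (eventually_ge_atTop (6 * M))).exists_forall_of_atTop
  refine ⟨max ρ₁ (6 * M), lt_of_lt_of_le (by positivity) (le_max_right _ _), ?_⟩
  intro r xc hr hr' hxc ρ hρ y hy
  have hρ1 : ρ₁ ≤ ρ := (le_max_left _ _).trans hρ
  obtain ⟨hKε, hρ6⟩ := hρ₁ ρ hρ1
  have hρ0 : 0 < ρ := lt_of_lt_of_le (by positivity) hρ6
  have hy0 : 0 < y := lt_of_lt_of_le (by norm_num) hy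
  -- the unscaled estimate at `x = xc + ρ y`, `d = ρ y ≥ 3M`
  have hd : xc + 3 * M ≤ xc + ρ * y := by nlinarith
  have hfar := rwPotential_far_asymptotics hM hr hr' hxc s ℓ hs (x := xc + ρ * y) hd
  have hdxy : xc + ρ * y - xc = ρ * y := by ring
  rw [hdxy] at hfar
  -- rescale: `ρ² (V − L/(ρy)²) = ρ²V − L/y²`
  have hρy : 0 < ρ * y := mul_pos hρ0 hy0
  have hresc : ρ ^ 2 * ((1 - 2 * M / r (xc + ρ * y)) * (L / r (xc + ρ * y) ^ 2
        + (1 - (s : ℝ) ^ 2) * (2 * M) / r (xc + ρ * y) ^ 3)) - L / y ^ 2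
      = ρ ^ 2 * ((1 - 2 * M / r (xc + ρ * y)) * (L / r (xc + ρ * y) ^ 2
        + (1 - (s : ℝ) ^ 2) * (2 * M) / r (xc + ρ * y) ^ 3) - L / (ρ * y) ^ 2) := by
    rw [mul_sub]
    congr 1
    field_simp
  rw [hresc, abs_mul, abs_of_pos (by positivity : (0 : ℝ) < ρ ^ 2)]
  -- the logarithm: `1 + log(1 + ρy/M) ≤ 6 (1 + log(1+ρ/M)) √y`
  have hA0 : 0 ≤ Real.log (1 + ρ / M) := Real.log_nonneg (by
    have := div_nonneg hρ0.le hM.le; linarith)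
  have hlog : 1 + Real.log (1 + ρ * y / M) ≤ 6 * (1 + Real.log (1 + ρ / M)) * Real.sqrt y := by
    have hB : Real.log (1 + ρ * y / M) ≤ Real.log (1 + ρ / M) + Real.log (1 + y) := by
      rw [← Real.log_mul (by positivity) (by positivity)]
      refine Real.log_le_log (by positivity) ?_
      have e : (1 + ρ / M) * (1 + y) = 1 + ρ * y / M + (y + ρ / M) := by ring
      have : 0 ≤ y + ρ / M := by positivity
      linarith
    have hBy : Real.log (1 + y) ≤ 4 * Real.sqrt y := by
      have h1 := log_one_add_le_two_sqrt (y := y) (by linarith)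
      have h2 : Real.sqrt (1 + y) ≤ 2 * Real.sqrt y := by
        rw [Real.sqrt_le_left (by positivity), mul_pow, Real.sq_sqrt hy0.le]
        linarith
      linarith
    have hone : 1 ≤ 2 * Real.sqrt y := by
      have : Real.sqrt (1 / 2) ≤ Real.sqrt y := Real.sqrt_le_sqrt hy
      have h12 : (1 / 2 : ℝ) ≤ Real.sqrt (1 / 2) := by
        rw [Real.le_sqrt (by norm_num) (by norm_num)]; norm_num
      linarith
    have hsy0 : 0 ≤ Real.sqrt y := Real.sqrt_nonneg y
    nlinarith [hB, hBy, hone, hA0, mul_nonneg hA0 hsy0]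
  -- combine
  have hy52 : y ^ (-(5 : ℝ) / 2) = Real.sqrt y / y ^ 3 := by
    rw [Real.sqrt_eq_rpow, show (-(5 : ℝ) / 2) = 1 / 2 - 3 by norm_num,
      Real.rpow_sub hy0, show (3 : ℝ) = ((3 : ℕ) : ℝ) by norm_num, Real.rpow_natCast]
  rw [hy52]
  have hbound : ρ ^ 2 * (200 * M * (L + 1) * (1 + Real.log (1 + ρ * y / M)) / (ρ * y) ^ 3)
      ≤ ε * (Real.sqrt y / y ^ 3) := by
    have e : ρ ^ 2 * (200 * M * (L + 1) * (1 + Real.log (1 + ρ * y / M)) / (ρ * y) ^ 3)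
        = (200 * M * (L + 1) / ρ) * (1 + Real.log (1 + ρ * y / M)) / y ^ 3 := by
      field_simp
    have hnum : (200 * M * (L + 1) / ρ) * (1 + Real.log (1 + ρ * y / M)) ≤ ε * Real.sqrt y :=
      calc (200 * M * (L + 1) / ρ) * (1 + Real.log (1 + ρ * y / M))
          ≤ (200 * M * (L + 1) / ρ) * (6 * (1 + Real.log (1 + ρ / M)) * Real.sqrt y) :=
            mul_le_mul_of_nonneg_left hlog (by positivity)
        _ = K * ((1 + Real.log (1 + ρ / M)) / ρ) * Real.sqrt y := by rw [hK]; field_simp; ring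
        _ ≤ ε * Real.sqrt y := mul_le_mul_of_nonneg_right hKε (Real.sqrt_nonneg y)
    calc ρ ^ 2 * (200 * M * (L + 1) * (1 + Real.log (1 + ρ * y / M)) / (ρ * y) ^ 3)
        = (200 * M * (L + 1) / ρ) * (1 + Real.log (1 + ρ * y / M)) / y ^ 3 := e
      _ ≤ (ε * Real.sqrt y) / y ^ 3 := div_le_div_of_nonneg_right hnum (by positivity)
      _ = ε * (Real.sqrt y / y ^ 3) := by ring
  exact (mul_le_mul_of_nonneg_left hfar (by positivity)).trans hbound

end Summit.FinalStateConjecture.FinalStateConjecture.Theorems
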